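import Summits.BirchSwinnertonDyer.Rank1Residual.X11b.Three.RouteR1LowerFromDivisibility
import Summits.BirchSwinnertonDyer.Rank1Residual.GaloisImage.PropagatedConditionCardEP
import HarnessLib

/-!
# X11b at `p = 3`, route R1 — the S8♮ ENDs with the cited Euler–Poincaré binder `hEP` DISCHARGED
# (cell `b2b-bsdres`, team `x11b3`, seat p6; consumer touch T-EPC of lead rulings R12-2 / R12-20)

HONEST FRAMING (cell `b2b-bsdres`, run/shared/lean/b2b/bsd-rank1-residual/, verbatim in every
file): the goal of the cell is to DELETE the COMBINATION-SHAPED residual classes of the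
Birch–Swinnerton-Dyer formula for ALL analytic-rank `≤ 1` elliptic curves over `ℚ` — "full BSD
formula for every rank `≤ 1` curve in class `C`" assembled STRICTLY from published theorems — so
that the rank-`≤ 1` remainder becomes exactly the CONSTRUCTION-SHAPED classes, which are TYPED
(missing-input `Prop`s), NOT attempted. This is not "finishing BSD". Team `x11b3` (N8/O2: X11b at
`p = 3`); a RESEARCH ROUTE; no claim beyond the stated class; X11 ∧ `r = 1` at `p = 3` stays
CONSTRUCTION-SHAPED / O2 OPEN; nothing here books anything or changes a label. THEOREMS ONLY: no
definition, no named fact, no `sorry`. Treaty (lead R10-67 / R12-2): multr1-p1's `R1.` records and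
multr1-p2's `P2.` records re-issue their own `hEP` binder (their rows T6 / T9); this file touches
ONLY the `Three.*` S8♮ theorems of `Three/RouteR1LowerFromDivisibility.lean` (seat p6) — no overlap.

## Why

Every theorem of `Three/RouteR1LowerFromDivisibility.lean` (S8♮ FILE B: the `≥`-half (A≥|VoR)@3 of
Castella's display (5.3) at `3` DERIVED from the one-sided Λ-adic shape
`Three.IMCDivIntFrameAtErratumData₃`, and route R1@3's end forms fed by it) carries, next to the
published named facts and the OPEN shape, TWO cited cohomological binders inherited from the
one-sided control theorem (CTL≤)ᵗ (`controlUpperOnTreeAt_of_isErratumField`):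
`hPT` — Poitou–Tate (Milne, *ADT* I.4.10), and
`hEP : ∀ K [NumberField K] (v), localEulerPoincareCharacteristic (v.adicCompletion K)` — Tate's
local Euler–Poincaré characteristic formula (Milne, *ADT* I.2.8) at every finite place of every
number field. Team n1011 (row T-EPC: `GaloisImage/EPCTateFormula.lean`,
`GaloisImage/LocalEulerPoincareCharacteristicHolds.lean`) has PROVED the named fact outright —
`EPCTate.localEulerPoincareCharacteristic F` / `localEulerPoincareCharacteristic_holds F` for every
non-archimedean local field `F` of characteristic `0` — and instantiated it at `F := K_v`
(`GaloisImage.EP.localEulerPoincareCharacteristic_adicCompletion`, `PropagatedConditionCardEP.lean`),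
which DISCHARGES `hEP`; this file re-issues the five S8♮ theorems without that binder (lead rulings
R12-2 / R12-20: ONE consumer touch; `hPT` STAYS cited — no local class field theory invariant maps in
the tree). FILE B is at the 400-line cap, so the re-issues live here (append-only in spirit: FILE B
is imported, never restated; each proof is FILE B's theorem with `hEP` supplied by name).

## What this file proves

The primed twins, binder lists = FILE B's token for token with `hEP` REMOVED and nothing else
touched (NIT-4 of record: the `exists_isNewformOf` binder keeps FILE B's name `hnf`), each proved
by FILE B's theorem with `hEP :=` n1011's `GaloisImage.EP.localEulerPoincareCharacteristic_adicCompletion`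
(`GaloisImage/PropagatedConditionCardEP.lean`: Tate's formula at the completion `K_v` of any number
field at any finite place — "the shape of every `hEP` binder in the cell" — from
`EPCTate.localEulerPoincareCharacteristic`, the theorem form of the named fact, whose `_root_` twin is
`localEulerPoincareCharacteristic_holds`; imported by name, never restated):
* §1 `Three.imcLowerWaldspurgerOnTreeAt_three_of_imcDivIntFrameAtErratumData₃'` (pointwise
  `(IMC≥∘BDP)ᵗ` at an R1@3 erratum datum from the shape);
* §1 `Three.display53LowerAt_three_of_imcDivIntFrameAtErratumData₃'` ((A≥|VoR)@3 at the datum);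
* §2 `Three.R1.missingLowerBoundAt_three_of_imcDivIntFrameAtErratumData₃'`,
  `Three.R1.bsdp_three_of_imcDivIntFrameAtErratumData₃_of_not_dvd_tamagawaProduct'`,
  `Three.R1.bsdp_three_of_imcDivIntFrameAtErratumData₃_at'` (route R1@3's end forms).

WORDING OF RECORD (lead R10-67 / R12-2, binding): plumbing on route R1@3: (A≥)@3 DERIVED from the
(2.4)♭@3 shape + (CTL≤)ᵗ@3 + (TAM-q)@odd p; the shape is OPEN at 3; (A≥|VoR)@3 NOT discharged — the
open input moves one level down, is not removed; nothing booked. What changed here: ONE CITED input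
(`hEP`, Milne I.2.8) is now a TREE THEOREM (n1011 T-EPC) and leaves the binder lists; the OPEN
input `Three.IMCDivIntFrameAtErratumData₃` (never a theorem in this cell, no `_holds`), the cited
`hPT`, every published named-fact binder, the node `Three.HsiehDescentAt₃`, v4.3 / v4.5 and all
counts are UNCHANGED; every result below is CONDITIONAL on the shape; discharges nothing on the
residual map.

References: [Castella2018Erratum] (2.4), Thm. A′; [Castella2018] Thms. 2.3, 3.1, 3.2, §5 (5.1)–(5.3)
(arXiv:1704.06608 pp. 5, 9, 12); [JetchevSkinnerWan2017] §7.4.1 (eq:shalowerK-1); [MilneADT2006]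
I.4.10(b), I.2.8 (p. 31); [GreenbergLNM1716] Lemma 3.3; [McCallumLMS1991] §1; [Miller2011LMS] Def. 1.1.
-/

noncomputable section

open scoped Classical

open WeierstrassCurve NumberField IsDedekindDomain Field PowerSeries
open Literature.NumberTheory.EllipticCurves Literature.NumberTheory.EllipticCurves.GreenbergSelmer
  Literature.NumberTheory.EllipticCurves.ModularForms Literature.NumberTheory.EllipticCurves.Rank1Residual
  Literature.NumberTheory.EllipticCurves.Rank1Residual.Typed Literature.NumberTheory.EllipticCurves.Castella2018
  Literature.NumberTheory.GaloisRepresentations Literature.NumberTheory.GaloisCohomology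
open Summit.BirchSwinnertonDyer.Rank1Residual.X11b.AcSelmer Summit.BirchSwinnertonDyer.Rank1Residual.X11b.Halves

namespace Summit.BirchSwinnertonDyer.Rank1Residual.X11b.Three

/-! ### §1 The pointwise input and the `≥`-half at an R1@3 erratum datum, `hEP` discharged -/

section Pointwise

variable {W : WeierstrassCurve ℚ} [W.IsElliptic] [W.IsGloballyMinimal]
  {K : Type} [Field K] [NumberField K]

/-- **Route p2's POINTWISE open input `(IMC≥∘BDP)ᵗ` AT AN R1@3 ERRATUM DATUM from the one-sided
shape at `3`, the cited Euler–Poincaré binder DISCHARGED** —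
`Three.imcLowerWaldspurgerOnTreeAt_three_of_imcDivIntFrameAtErratumData₃` (FILE B §2) with its
binder `hEP` (Tate's local Euler–Poincaré characteristic formula at every finite place of every
number field, Milne *ADT* I.2.8) SUPPLIED by n1011's tree theorem
`GaloisImage.EP.localEulerPoincareCharacteristic_adicCompletion` (the named fact PROVED, at `K_v`); every other binder token for token:
GZK, modularity `hnf`, cited Poitou–Tate `hPT`, `ι : ℚ̄₃ ≅ ℂ`, the OPEN shape
`hD : Three.IMCDivIntFrameAtErratumData₃ W`, and the R1@3 erratum datum. CONDITIONAL on the shape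
(OPEN at `3`); discharges nothing; nothing booked.
[cite: Castella2018, Thms. 2.3, 3.1, 3.2 and §5 (arXiv:1704.06608 pp. 5, 9, 12)] [cite: Castella2018Erratum, (2.4) (p. 4)]
[cite: MilneADT2006, Ch. I, Thm. 4.10(b) and Thm. 2.8 (p. 31)] [cite: GreenbergLNM1716, §3 Lemma 3.3 (p. 87)] -/
theorem imcLowerWaldspurgerOnTreeAt_three_of_imcDivIntFrameAtErratumData₃'
    (hGZK : rank_eq_analyticRank_of_analyticRank_le_one) (hnf : exists_isNewformOf)
    (hPT : ∀ (K : Type) [Field K] [NumberField K], poitouTate_sum_localTatePairing_eq_zero K)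
    (ι : PadicAlgCl 3 ≃+* ℂ) (hD : IMCDivIntFrameAtErratumData₃ W)
    [NeZero (W.conductorNorm ℤ)] {q : ℕ} [Fact q.Prime]
    (Dt : ModularParametrizationData W (W.conductorNorm ℤ))
    (H : HeegnerDatum (W.conductorNorm ℤ) (NumberField.discr K)) (ιK : K →+* ℂ)
    {P : (W.baseChange K).toAffine.Point} (hX : IsX11Three W) (hloc : X11.AprimeLocusAt W 3)
    (hq3 : q ≠ 3) (hmq : Mult W q) (hns : ¬ W.HasSplitMultiplicativeReductionAtPrime q)
    (hvq : ¬ 3 ∣ padicValInt q W.minimalDiscriminantInt) (hK : IsErratumField W K q)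
    (hCas : Cas20Standing K 3 (W.conductorNorm ℤ / 3))
    (hP : WeierstrassCurve.Affine.Point.map ιK.toRatAlgHom P = heegnerPointComplex Dt H)
    (hc : ¬ (3 : ℤ) ∣ Dt.c) (hinf : ¬ IsOfFinAddOrder P)
    {κ : ZpExtension K 3} (hκ : κ.IsAnticyclotomic) (γ : Field.absoluteGaloisGroup K)
    [Fact (κ.IsTopGenerator γ)]
    (𝔭 : HeightOneSpectrum (𝓞 K)) (h𝔭 : ((3 : ℕ) : 𝓞 K) ∈ 𝔭.asIdeal)
    (he : 𝔭.asIdeal.ramificationIdx (𝓞 ℚ) = 1) (hf : 𝔭.asIdeal.inertiaDeg (𝓞 ℚ) = 1) :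
    IMCLowerWaldspurgerOnTreeAt 3 κ 𝔭 γ (embAt K 3 𝔭 h𝔭 he hf) P :=
  imcLowerWaldspurgerOnTreeAt_three_of_imcDivIntFrameAtErratumData₃ hGZK hnf hPT
    GaloisImage.EP.localEulerPoincareCharacteristic_adicCompletion
    ι hD Dt H ιK hX hloc hq3 hmq hns hvq hK hCas hP hc hinf hκ γ 𝔭 h𝔭 he hf

/-- **The `≥`-HALF of Castella's display (5.3) at `3` — (A≥|VoR)@3 = `Display53LowerAt W 3 K P` —
AT AN R1@3 ERRATUM DATUM from the one-sided shape at `3`, the cited Euler–Poincaré binder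
DISCHARGED** — `Three.display53LowerAt_three_of_imcDivIntFrameAtErratumData₃` (FILE B §3) with
`hEP` SUPPLIED by n1011's `GaloisImage.EP.localEulerPoincareCharacteristic_adicCompletion`; every other binder token
for token (GZK, `hnf`, cited `hPT`, the OPEN shape `hD`, the datum):
`2·ord₃[E(K):ℤP] − ord₃ ∏_w c_w(E/K) ≤ ord₃ #Ш(E/K)[3^∞]`. CONDITIONAL on the shape (OPEN at `3`);
one open input moved one level down, NOT removed; discharges nothing; nothing booked.
[cite: Castella2018, §5 (5.1)–(5.3) (arXiv:1704.06608 p. 12)]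
[cite: JetchevSkinnerWan2017, §7.4.1 (eq:shalowerK-1)] [cite: MilneADT2006, Ch. I, Thm. 2.8 (p. 31)] -/
theorem display53LowerAt_three_of_imcDivIntFrameAtErratumData₃'
    (hGZK : rank_eq_analyticRank_of_analyticRank_le_one) (hnf : exists_isNewformOf)
    (hPT : ∀ (K : Type) [Field K] [NumberField K], poitouTate_sum_localTatePairing_eq_zero K)
    (hD : IMCDivIntFrameAtErratumData₃ W)
    [NeZero (W.conductorNorm ℤ)] {q : ℕ} [Fact q.Prime]
    (Dt : ModularParametrizationData W (W.conductorNorm ℤ))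
    (H : HeegnerDatum (W.conductorNorm ℤ) (NumberField.discr K)) (ιK : K →+* ℂ)
    {P : (W.baseChange K).toAffine.Point} (hX : IsX11Three W) (hloc : X11.AprimeLocusAt W 3)
    (hq3 : q ≠ 3) (hmq : Mult W q) (hns : ¬ W.HasSplitMultiplicativeReductionAtPrime q)
    (hvq : ¬ 3 ∣ padicValInt q W.minimalDiscriminantInt) (hK : IsErratumField W K q)
    (hCas : Cas20Standing K 3 (W.conductorNorm ℤ / 3))
    (hP : WeierstrassCurve.Affine.Point.map ιK.toRatAlgHom P = heegnerPointComplex Dt H)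
    (hc : ¬ (3 : ℤ) ∣ Dt.c) (hinf : ¬ IsOfFinAddOrder P) :
    Display53LowerAt W 3 K P :=
  display53LowerAt_three_of_imcDivIntFrameAtErratumData₃ hGZK hnf hPT
    GaloisImage.EP.localEulerPoincareCharacteristic_adicCompletion
    hD Dt H ιK hX hloc hq3 hmq hns hvq hK hCas hP hc hinf

end Pointwise

/-! ### §2 Route R1's `p = 3` end forms from the shape, `hEP` discharged -/

section EndForms

/-- **The main-conjecture half of `BSD(E,3)` on route R1@3's population from (2.4)♭@3, the cited
Euler–Poincaré binder DISCHARGED** — `Three.R1.missingLowerBoundAt_three_of_imcDivIntFrameAtErratumData₃`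
(FILE B §4) with `hEP` SUPPLIED by n1011's `GaloisImage.EP.localEulerPoincareCharacteristic_adicCompletion`; all other binders token
for token: for `W/ℚ` globally minimal with `IsX11Three W` on the A′ ∧ (ram2)-locus at `3`, an odd
non-split multiplicative `q ≠ 3` with `3 ∤ v_q(Δ_min)` and an erratum field `K` for `q`,
`Typed.MissingLowerBoundAt W 3` from SEVEN published named facts (`hGZ` GZ86 I.7.3, `hGZK`, `hSk`
Skinner 2016 Thm. C, `hnf`, `hCST` CST14 Thm. 1.1, `hMaz`, `hNS`), the cited `hPT` (Milne ADT
I.4.10), and the ONE OPEN class-level input `hD : ∀ W, Three.IMCDivIntFrameAtErratumData₃ W` (NOT a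
cited fact; no announcement at `3`). CONDITIONAL on `hD`; deletes nothing; X11 ∧ `r = 1` at `3`
stays CONSTRUCTION-SHAPED.
[cite: Castella2018, §5 (arXiv:1704.06608 p. 12)] [cite: JetchevSkinnerWan2017, §7.4.1 (eq:shalowerK-1)]
[cite: Castella2018Erratum, (2.4) and Thm. A′ (pp. 1, 4) with "p > 3" read as "p = 3" (shape only; nothing asserted)]
[cite: MilneADT2006, Ch. I, Thm. 2.8 (p. 31)] -/
theorem R1.missingLowerBoundAt_three_of_imcDivIntFrameAtErratumData₃'
    (hGZ : GrossZagier1986_thm_I_7_3) (hGZK : rank_eq_analyticRank_of_analyticRank_le_one)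
    (hSk : Skinner2016.thmC_padicValRat_bsd_rank_zero) (hnf : exists_isNewformOf)
    (hCST : CaiShuTian2014.thm11_trivialChar)
    (hMaz : mazur_not_dvd_maninConstant_of_odd) (hNS : integral_neronScaling_of_isGloballyMinimal)
    (hPT : ∀ (K : Type) [Field K] [NumberField K], poitouTate_sum_localTatePairing_eq_zero K)
    (hD : ∀ (W : WeierstrassCurve ℚ) [W.IsElliptic] [W.IsGloballyMinimal],
      IMCDivIntFrameAtErratumData₃ W)
    (W : WeierstrassCurve ℚ) [W.IsElliptic] [W.IsGloballyMinimal]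
    (hX : IsX11Three W) (hloc : X11.AprimeRam2LocusAt W 3)
    (q : ℕ) [Fact q.Prime] (hq2 : q ≠ 2) (hq3 : q ≠ 3) (hmq : Mult W q)
    (hnsq : ¬ W.HasSplitMultiplicativeReductionAtPrime q)
    (hvq : ¬ 3 ∣ padicValInt q W.minimalDiscriminantInt)
    (K : Type) [Field K] [NumberField K] (hKf : IsErratumField W K q) :
    Typed.MissingLowerBoundAt W 3 :=
  R1.missingLowerBoundAt_three_of_imcDivIntFrameAtErratumData₃ hGZ hGZK hSk hnf hCST hMaz hNS hPT
    GaloisImage.EP.localEulerPoincareCharacteristic_adicCompletion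
    hD W hX hloc q hq2 hq3 hmq hnsq hvq K hKf

/-- **`BSD(E,3)` on route R1@3's population ∩ {`3 ∤ ∏_ℓ c_ℓ(E)`} from (2.4)♭@3, the cited
Euler–Poincaré binder DISCHARGED** —
`Three.R1.bsdp_three_of_imcDivIntFrameAtErratumData₃_of_not_dvd_tamagawaProduct` (FILE B §4, the
`p = 3` twin of multr1-p2's hybrid record) with `hEP` SUPPLIED by n1011's
`GaloisImage.EP.localEulerPoincareCharacteristic_adicCompletion`; all other binders token for token: UPPER half = multr1-p2's
Kolyvagin theorem at a classical Heegner field (`hGZ hKo hB hSk hGZK hmod hnf hHL hMaz hNS`), LOWER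
half = route R1 at `3` (`hGZ1 hCST hFH`) fed by FILE B §3 (+ cited `hPT`). So on R1@3's population
∩ A1 the kernel asks of the literature — beyond PUBLISHED theorems, the tree's Euler–Poincaré
theorem and the cited Poitou–Tate — EXACTLY the one-sided shape (2.4)♭@3 at the erratum data,
nothing per pair. CONDITIONAL on `hD` (OPEN at `3`); deletes nothing; X11 ∧ `r = 1` at `3` stays
CONSTRUCTION-SHAPED; nothing booked.
[cite: McCallumLMS1991, §1 Theorem (Kolyvagin), p. 296] [cite: Castella2018, §5 (arXiv:1704.06608 p. 12)]
[cite: JetchevSkinnerWan2017, §7.4.1 (eq:shalowerK-1)] [cite: Miller2011LMS, Def. 1.1]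
[cite: MilneADT2006, Ch. I, Thm. 2.8 (p. 31)] -/
theorem R1.bsdp_three_of_imcDivIntFrameAtErratumData₃_of_not_dvd_tamagawaProduct'
    (hGZ : ∀ (N : ℕ) [NeZero N] (W : WeierstrassCurve ℚ) (K : Type) [Field K] [NumberField K],
      gross_zagier N W K)
    (hKo : ∀ (N : ℕ) [NeZero N] (W : WeierstrassCurve ℚ) (K : Type) [Field K] [NumberField K],
      kolyvagin N W K)
    (hB : ∀ (N : ℕ) [NeZero N] (W : WeierstrassCurve ℚ) (K : Type) [Field K] [NumberField K],
      Kolyvagin1990_padicValNat_card_sha_le N W K)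
    (hSk : Skinner2016.thmC_padicValRat_bsd_rank_zero)
    (hGZK : rank_eq_analyticRank_of_analyticRank_le_one) (hmod : hasEntireLFunction_rat)
    (hnf : exists_isNewformOf) (hHL : HoffsteinLuo1997_exists_twist_L_one_ne_zero)
    (hMaz : mazur_not_dvd_maninConstant_of_odd) (hNS : integral_neronScaling_of_isGloballyMinimal)
    (hGZ1 : GrossZagier1986_thm_I_7_3) (hCST : CaiShuTian2014.thm11_trivialChar)
    (hFH : friedbergHoffstein_exists_twist_ne_zero_ramifiedAt)
    (hPT : ∀ (K : Type) [Field K] [NumberField K], poitouTate_sum_localTatePairing_eq_zero K)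
    (hD : ∀ (W : WeierstrassCurve ℚ) [W.IsElliptic] [W.IsGloballyMinimal],
      IMCDivIntFrameAtErratumData₃ W)
    (W : WeierstrassCurve ℚ) [W.IsElliptic] [W.IsGloballyMinimal]
    (hX : IsX11Three W) (hloc : X11.AprimeRam2LocusAt W 3)
    (hq : ∃ (q : ℕ) (_ : Fact q.Prime), q ≠ 2 ∧ q ≠ 3 ∧ Mult W q ∧
      ¬ W.HasSplitMultiplicativeReductionAtPrime q ∧ ¬ 3 ∣ padicValInt q W.minimalDiscriminantInt)
    (htam : ¬ 3 ∣ W.tamagawaProduct) : BSDp W 3 :=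
  R1.bsdp_three_of_imcDivIntFrameAtErratumData₃_of_not_dvd_tamagawaProduct hGZ hKo hB hSk hGZK hmod
    hnf hHL hMaz hNS hGZ1 hCST hFH hPT
    GaloisImage.EP.localEulerPoincareCharacteristic_adicCompletion
    hD W hX hloc hq htam

/-- **`BSD(E,3)` for ONE curve at ONE R1@3 datum with `3 ∤ ∏_ℓ c_ℓ(E)`, from the one-sided shape
for THIS curve, the cited Euler–Poincaré binder DISCHARGED** —
`Three.R1.bsdp_three_of_imcDivIntFrameAtErratumData₃_at` (FILE B §4, through S8♭) with `hEP`
SUPPLIED by n1011's `GaloisImage.EP.localEulerPoincareCharacteristic_adicCompletion`; all other binders token for token: TEN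
published named-fact binders + cited `hPT` + the OPEN shape `hD : Three.IMCDivIntFrameAtErratumData₃ W`
for this `W` + the datum. Discharges nothing on the residual map; nothing booked.
[cite: Castella2018, §5 (arXiv:1704.06608 p. 12)] [cite: JetchevSkinnerWan2017, §7.4.1 (eq:shalowerK-1)]
[cite: McCallumLMS1991, §1 Theorem (Kolyvagin), p. 296] [cite: Miller2011LMS, Def. 1.1]
[cite: MilneADT2006, Ch. I, Thm. 2.8 (p. 31)] -/
theorem R1.bsdp_three_of_imcDivIntFrameAtErratumData₃_at'
    (hGZ : ∀ (N : ℕ) [NeZero N] (W : WeierstrassCurve ℚ) (K : Type) [Field K] [NumberField K],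
      gross_zagier N W K)
    (hKo : ∀ (N : ℕ) [NeZero N] (W : WeierstrassCurve ℚ) (K : Type) [Field K] [NumberField K],
      kolyvagin N W K)
    (hB : ∀ (N : ℕ) [NeZero N] (W : WeierstrassCurve ℚ) (K : Type) [Field K] [NumberField K],
      Kolyvagin1990_padicValNat_card_sha_le N W K)
    (hSk : Skinner2016.thmC_padicValRat_bsd_rank_zero)
    (hGZK : rank_eq_analyticRank_of_analyticRank_le_one) (hnf : exists_isNewformOf)
    (hHL : HoffsteinLuo1997_exists_twist_L_one_ne_zero) (hMaz : mazur_not_dvd_maninConstant_of_odd)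
    (hGZ1 : GrossZagier1986_thm_I_7_3) (hCST : CaiShuTian2014.thm11_trivialChar)
    (hPT : ∀ (K : Type) [Field K] [NumberField K], poitouTate_sum_localTatePairing_eq_zero K)
    (W : WeierstrassCurve ℚ) [W.IsElliptic] [W.IsGloballyMinimal] [NeZero (W.conductorNorm ℤ)]
    (hD : IMCDivIntFrameAtErratumData₃ W)
    (hX : IsX11Three W) (hloc : X11.AprimeRam2LocusAt W 3)
    (q : ℕ) [Fact q.Prime] (hq2 : q ≠ 2) (hq3 : q ≠ 3) (hmq : Mult W q)
    (hnsq : ¬ W.HasSplitMultiplicativeReductionAtPrime q)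
    (hvq : ¬ 3 ∣ padicValInt q W.minimalDiscriminantInt)
    (K : Type) [Field K] [NumberField K] (hKf : IsErratumField W K q)
    (Dt : ModularParametrizationData W (W.conductorNorm ℤ))
    (H : HeegnerDatum (W.conductorNorm ℤ) (NumberField.discr K)) (ι : K →+* ℂ)
    (P : (W.baseChange K).toAffine.Point)
    (hP : WeierstrassCurve.Affine.Point.map ι.toRatAlgHom P = heegnerPointComplex Dt H)
    (hc : ¬ (3 : ℤ) ∣ Dt.c) (hnt : ¬ IsOfFinAddOrder P) (htam : ¬ 3 ∣ W.tamagawaProduct) :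
    BSDp W 3 :=
  R1.bsdp_three_of_imcDivIntFrameAtErratumData₃_at hGZ hKo hB hSk hGZK hnf hHL hMaz hGZ1 hCST hPT
    GaloisImage.EP.localEulerPoincareCharacteristic_adicCompletion
    W hD hX hloc q hq2 hq3 hmq hnsq hvq K hKf Dt H ι P hP hc hnt htam

end EndForms

end Summit.BirchSwinnertonDyer.Rank1Residual.X11b.Three

end
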